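import Summits.QuantumFields.BalabanUV.T4Continuum.Support.NE7MajorantL1
import Summits.QuantumFields.BalabanUV.T4Continuum.Support.NE3DirIterMajorant
import Summits.QuantumFields.BalabanUV.T4Continuum.Support.NE3FramePotBoundW
import HarnessLib

/-!
# NE7FramePotCurvedL1 — THE `ℓ¹` LETTER OF THE ACCUMULATED FRAME POTENTIAL AT A CURVED BACKGROUND, k-UNIFORM:
# `Σ_{z∈[0,N)^d} ‖framePotW L (k+1) W Y z‖ ≤ (d·L)·(Σ_{i≤k} Π_{l<i} γ(x_l))·‖Y‖_{ℓ¹} ≤ 2·(d·L)·K_maj·‖Y‖_{ℓ¹}` for EVERY `W` of the multi-level class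
# (no gauge condition) — the letter `C_F` of the curved (TT) F70∕F71; letter (L4) of the curved (APE) programme, file 6

Cell `pub-balaban`, rung (B)+1 sub-cell t4, lineage `b2b-balaban-t4-ne7-p1` (CRUX PROVER NE7 #1 = OWNER of row NE7), generation 76; memo
`t4/b2b-balaban-t4-ne7-p1-g75/CURVED-APE-ROAD.md` §2 (L4).  File F72 (over leaf-04's `NE3DirIterMajorant` (the frame functional tower `frameMaj`, `treeStep`,
`norm_framePotW_le_frameMaj`: the accumulated frames are dominated POINTWISE at every `W` of the class), this lineage's `NE7MajorantL1` (one level in `L¹`: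
`sum_periodBox_stepMaj_le`; the `k`-free constant `prod_step_le`), `NE7PeriodicBlockSums.sum_periodBox_lsum_le`, `NE3FramePotBoundW.levelSmall_of_le`).
WHY.  F70 `NE7TangentTransportCurved.tangent_transport_curved` ∕ F71 display the frame letter `C_F`: `Σ_{z∈[0,N)^d} ‖framePotW L (k+1) W Y z‖ ≤ C_F·‖Y‖_{ℓ¹(periodBox T)}`
at the CURVED reference `W` (at flat, (139) `NE7FlatSliceStraightReduction.sum_norm_framePot_le` gives `C_fr = 2dL(2dL+1)^d`).  THIS FILE discharges it for every `W`
of the class with a `k`-FREE constant: the frame functional tower unrolls as `frameMaj (j+1) x ω = Σ_i treeStep(stepMaj^i ω)` read at `L^{j−i}`-multiples; one tree step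
costs `d·L` in `L¹` between the period boxes (`sum_periodBox_lsum_le`, tree words of length `≤ dL`, block weights summing to `1`), and `i` straight steps before it cost
`Π_{l<i} γ(x_l)` (`γ(x) = L∕L^d + d·wlin(x)·c_loc`, `NE7MajorantL1`); `Π_{l<i} γ(x_l) ≤ K_maj·(L∕L^d)^i` sums to `≤ 2K_maj` for `d ≥ 2`.
WHAT ([folklore]; 0 def, 0 sorry).
§1 `sum_periodBox_treeStep_le` — `Σ_{z∈[0,P)^d} treeStep L ω (Q•z) ≤ (d·L)·‖ω‖_{L¹(periodBox (P·Q·L))}` for a `(P·Q·L)`-periodic weight (`Q ≥ 1`).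
§2 **`sum_periodBox_frameMaj_le`** — THE FRAME TOWER IN `L¹`: `Σ_{z∈[0,N)^d} frameMaj d L (j+1) x ω z ≤ (d·L)·(Σ_{i<j+1} Π_{l<i} γ(x_l))·‖ω‖_{L¹(periodBox (N·L^{j+1}))}`.
§3 **`sum_norm_framePotW_le`** — THE `C_F` LETTER AT A CURVED `W`: `Σ_{z∈[0,N)^d} ‖framePotW L (k+1) W Y z‖ ≤ (d·L)·(Σ_{i<k+1} Π_{l<i} γ(x_l))·dirL1 Y (periodBox (N·L^{k+1}))`.
§4 **`sum_norm_framePotW_le_Kmaj`** — `≤ 2·(d·L)·K_maj·dirL1 Y (periodBox (N·L^{k+1}))` for `d ≥ 2`, `L ≥ 2`.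
HONEST FRAMING (page 1): lattice kinematics (an operator-norm count); nothing about minimisers; (APE) NOT proved; NOT ONE-STEP, NOT NE7; spine 0∕9; finite T⁴ rung
(B)+1 — NOT infinite volume, NOT mass gap, NOT `BetaPertH`, NOT Clay.  Continuum YM on T⁴ ⇐ BetaPertH ∧ nine spine estimates (0/9 proved); BetaPertH ⇐ (D1) ∧ (D4) ∧
CAP+tail; G-an2-4 gates asym, D1 and NE2/3/4.
-/

set_option autoImplicit false

open scoped BigOperators Matrix.Norms.L2Operator
open Finset

namespace Summit.QuantumFields.BalabanUV.T4Continuum.NE7FramePotCurvedL1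

open Literature.MathematicalPhysics.QuantumFieldTheory.Balaban1983to89
open B7Prop1Explicit B7Prop2Explicit
open T4AveragingDeficitWall (IsUnitaryCfg SmallField dirL1)
open T4AveragingDeficitWallBoundary (periodBox)
open AveragingDeficitPeriodicCounting (IsPeriodicDir)
open AveragingDeficitTwoLevelPrep (prop1Radius twoLevelSmall)
open AveragingDeficitMultiLevelPrep (LevelSmall prop1Radius_nonneg)
open BlockAverageVaryHolo (nbRad)
open BlockAveragePushDirSplit (sum_blockWeight_eq_one)
open NE3TangentCovariantTower (framePotW)
open NE3QbarIterMajorant (lsum wlin wlin_nonneg stepMaj stepMaj_nonneg)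
open NE3DirIterMajorant (treeW₀ treeStep frameMaj frameMaj_succ frameMaj_zero norm_framePotW_le_frameMaj)
open NE3FramePotBoundW (levelSmall_of_le)
open NE7PeriodicBlockSums (sum_periodBox_lsum_le)
open NE7MajorantL1 (sum_periodBox_stepMaj_le prod_step_le iterate_prop1Radius_nonneg stepMaj_add_period)

noncomputable section

variable {d : ℕ}

/-! ## §1 One tree step in `L¹` -/

/-- **ONE TREE STEP COSTS `d·L` IN `L¹`**: for `Q ≥ 1` and a nonnegative `(P·Q·L)`-periodic weight `ω`,
`Σ_{z∈[0,P)^d} treeStep L ω (Q•z) ≤ (d·L)·Σ_{y∈periodBox (P·(Q·L))} Σ_μ ω(y,μ)` (tree words of length `≤ dL`, block weights summing to `1`). [folklore] -/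
theorem sum_periodBox_treeStep_le {P L Q : ℕ} [NeZero P] (hL : 1 ≤ L) (hQ : 1 ≤ Q) {ω : Site d → Fin d → ℝ}
    (hω0 : ∀ (y : Site d) (μ : Fin d), 0 ≤ ω y μ)
    (hωP : ∀ (y : Site d) (i : Fin d) (μ : Fin d), ω (y + ((P * (Q * L) : ℕ) : ℤ) • e i) μ = ω y μ) :
    ∑ z ∈ periodBox (d := d) P, treeStep L ω ((Q : ℤ) • z) ≤ ((d : ℝ) * L) * ∑ y ∈ periodBox (d := d) (P * (Q * L)), ∑ μ : Fin d, ω y μ := by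
  have hQL : 1 ≤ Q * L := Nat.one_le_iff_ne_zero.mpr (Nat.mul_ne_zero (by omega) (by omega))
  set S : ℝ := ∑ y ∈ periodBox (d := d) (P * (Q * L)), ∑ μ : Fin d, ω y μ with hS
  have hS0 : 0 ≤ S := Finset.sum_nonneg fun y _ => Finset.sum_nonneg fun μ _ => hω0 y μ
  have hsm : ∀ z : Site d, (L : ℤ) • ((Q : ℤ) • z) = ((Q * L : ℕ) : ℤ) • z := fun z => by
    rw [smul_smul]; push_cast; rw [mul_comm]
  have hz : ∀ z : Site d, treeStep L ω ((Q : ℤ) • z)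
      = ∑ r : Fin d → Fin L, ((L : ℝ) ^ d)⁻¹ * lsum ω (((Q * L : ℕ) : ℤ) • z + 0) (treeWord (boxVec L r)) := by
    intro z; simp only [treeStep, treeW₀, hsm z, add_zero]
  simp only [hz]
  rw [Finset.sum_comm]
  calc ∑ r : Fin d → Fin L, ∑ z ∈ periodBox (d := d) P, ((L : ℝ) ^ d)⁻¹ * lsum ω (((Q * L : ℕ) : ℤ) • z + 0) (treeWord (boxVec L r))
      ≤ ∑ _r : Fin d → Fin L, ((L : ℝ) ^ d)⁻¹ * (((d : ℝ) * L) * S) := by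
        refine Finset.sum_le_sum fun r _ => ?_
        rw [← Finset.mul_sum]
        refine mul_le_mul_of_nonneg_left ?_ (by positivity)
        refine (sum_periodBox_lsum_le (P := P) (L := Q * L) hQL hω0 hωP (treeWord (boxVec L r)) 0).trans
          (mul_le_mul_of_nonneg_right ?_ hS0)
        rw [length_treeWord]
        exact_mod_cast l1_boxVec_le L r
    _ = ((d : ℝ) * L) * S := by rw [← Finset.sum_mul, sum_blockWeight_eq_one L hL, one_mul]

/-! ## §2 The frame functional tower in `L¹` -/

/-- **THE FRAME TOWER IN `L¹`**: for `x ≥ 0` and a nonnegative weight `ω` of period `N·L^{j+1}`,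
`Σ_{z∈[0,N)^d} frameMaj d L (j+1) x ω z ≤ (d·L)·(Σ_{i<j+1} Π_{l<i} (L∕L^d + d·wlin(x_l)·c_loc))·‖ω‖_{L¹(periodBox (N·L^{j+1}))}`, `x_l = prop1Radius^[l] x`
(inner-first induction: the recursive call at `stepMaj x ω` costs `γ(x)` in mass, the tree step `d·L`). [folklore] -/
theorem sum_periodBox_frameMaj_le {L : ℕ} (hL : 1 ≤ L) : ∀ (j : ℕ) (N : ℕ) [NeZero N] (x : ℝ), 0 ≤ x →
    ∀ (ω : Site d → Fin d → ℝ), (∀ (y : Site d) (μ : Fin d), 0 ≤ ω y μ) →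
      (∀ (y : Site d) (i : Fin d) (μ : Fin d), ω (y + ((N * L ^ (j + 1) : ℕ) : ℤ) • e i) μ = ω y μ) →
      ∑ z ∈ periodBox (d := d) N, frameMaj d L (j + 1) x ω z
        ≤ (((d : ℝ) * L) * ∑ i ∈ Finset.range (j + 1), ∏ l ∈ Finset.range i, ((L : ℝ) / (L : ℝ) ^ d
              + (d : ℝ) * wlin d L ((prop1Radius d L)^[l] x) * (1250 * ((nbRad d L : ℝ) + L) + 8 * ((d : ℝ) * L) + 2 * L)))
          * ∑ y ∈ periodBox (d := d) (N * L ^ (j + 1)), ∑ μ : Fin d, ω y μ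
  | 0, N, _, x, _, ω, hω0, hωP => by
    have h1 := sum_periodBox_treeStep_le (P := N) (Q := 1) (d := d) hL le_rfl hω0 (by simpa using hωP)
    simp only [zero_add, frameMaj_succ, frameMaj_zero, pow_zero, Nat.cast_one, one_smul, Finset.sum_range_one, Finset.prod_range_zero,
      mul_one, pow_one]
    simpa using h1
  | j + 1, N, _, x, hx, ω, hω0, hωP => by
    haveI : NeZero (N * L ^ (j + 1)) := ⟨Nat.mul_ne_zero (NeZero.ne N) (pow_ne_zero _ (by omega))⟩
    set c : ℝ := 1250 * ((nbRad d L : ℝ) + L) + 8 * ((d : ℝ) * L) + 2 * L with hc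
    have hc0 : 0 ≤ c := by rw [hc]; positivity
    -- the first step's output: nonnegative, `N·L^{j+1}`-periodic
    have hper : ∀ (y : Site d) (i : Fin d) (μ : Fin d), ω (y + ((N * L ^ (j + 1) * L : ℕ) : ℤ) • e i) μ = ω y μ := by
      intro y i μ; rw [show N * L ^ (j + 1) * L = N * L ^ (j + 1 + 1) by ring]; exact hωP y i μ
    have h0' : ∀ (y : Site d) (μ : Fin d), 0 ≤ stepMaj d L x ω y μ := stepMaj_nonneg d L hx hω0
    have hP' : ∀ (y : Site d) (i : Fin d) (μ : Fin d), stepMaj d L x ω (y + ((N * L ^ (j + 1) : ℕ) : ℤ) • e i) μ = stepMaj d L x ω y μ :=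
      fun y i μ => stepMaj_add_period L x hper y i μ
    have ih := sum_periodBox_frameMaj_le hL j N (prop1Radius d L x) (prop1Radius_nonneg (d := d) hx) (stepMaj d L x ω) h0' hP'
    have hstep := sum_periodBox_stepMaj_le (P := N * L ^ (j + 1)) hL hω0 hper hx
    -- the tree step at the finest level, read at `L^{j+1}`-multiples
    have hQ : 1 ≤ L ^ (j + 1) := Nat.one_le_iff_ne_zero.mpr (pow_ne_zero _ (by omega))
    have hωP' : ∀ (y : Site d) (i : Fin d) (μ : Fin d), ω (y + ((N * (L ^ (j + 1) * L) : ℕ) : ℤ) • e i) μ = ω y μ := by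
      intro y i μ; rw [show N * (L ^ (j + 1) * L) = N * L ^ (j + 1 + 1) by ring]; exact hωP y i μ
    have htree := sum_periodBox_treeStep_le (P := N) (Q := L ^ (j + 1)) (d := d) hL hQ hω0 hωP'
    -- abbreviations
    set S : ℝ := ∑ y ∈ periodBox (d := d) (N * L ^ (j + 1 + 1)), ∑ μ : Fin d, ω y μ with hS
    set γ : ℕ → ℝ := fun l => (L : ℝ) / (L : ℝ) ^ d + (d : ℝ) * wlin d L ((prop1Radius d L)^[l] x) * c with hγ
    have hγ0 : ∀ l, 0 ≤ γ l := fun l => by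
      simp only [hγ]
      exact add_nonneg (by positivity) (mul_nonneg (mul_nonneg (Nat.cast_nonneg _) (wlin_nonneg d L (iterate_prop1Radius_nonneg (d := d) L l hx))) hc0)
    set PS : ℝ := ∑ i ∈ Finset.range (j + 1), ∏ l ∈ Finset.range i, γ (l + 1) with hPS
    have hPS0 : 0 ≤ PS := Finset.sum_nonneg fun i _ => Finset.prod_nonneg fun l _ => hγ0 _
    have hshift : (∑ i ∈ Finset.range (j + 1), ∏ l ∈ Finset.range i, ((L : ℝ) / (L : ℝ) ^ d
        + (d : ℝ) * wlin d L ((prop1Radius d L)^[l] (prop1Radius d L x)) * c)) = PS := by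
      rw [hPS]; refine Finset.sum_congr rfl fun i _ => Finset.prod_congr rfl fun l _ => ?_
      simp only [hγ, Function.iterate_succ_apply]
    rw [hshift] at ih
    have hbox1 : periodBox (d := d) (N * L ^ (j + 1) * L) = periodBox (d := d) (N * L ^ (j + 1 + 1)) := by
      rw [show N * L ^ (j + 1) * L = N * L ^ (j + 1 + 1) by ring]
    have hbox2 : periodBox (d := d) (N * (L ^ (j + 1) * L)) = periodBox (d := d) (N * L ^ (j + 1 + 1)) := by
      rw [show N * (L ^ (j + 1) * L) = N * L ^ (j + 1 + 1) by ring]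
    rw [hbox1] at hstep
    rw [hbox2] at htree
    have hγx : ((L : ℝ) / (L : ℝ) ^ d + (d : ℝ) * wlin d L x * c) = γ 0 := by simp only [hγ, Function.iterate_zero, id]
    rw [hγx] at hstep
    -- the target constant: `Σ_{i<j+2} Π_{l<i} γ_l = 1 + γ_0·PS`
    have htarget : (∑ i ∈ Finset.range (j + 1 + 1), ∏ l ∈ Finset.range i, γ l) = PS * γ 0 + 1 := by
      rw [Finset.sum_range_succ', Finset.prod_range_zero, hPS, Finset.sum_mul]
      congr 1
      refine Finset.sum_congr rfl fun i _ => ?_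
      rw [Finset.prod_range_succ']
    -- assemble
    have hdL : 0 ≤ (d : ℝ) * L := by positivity
    calc ∑ z ∈ periodBox (d := d) N, frameMaj d L (j + 1 + 1) x ω z
        = ∑ z ∈ periodBox (d := d) N, frameMaj d L (j + 1) (prop1Radius d L x) (stepMaj d L x ω) z
            + ∑ z ∈ periodBox (d := d) N, treeStep L ω (((L ^ (j + 1) : ℕ) : ℤ) • z) := by
          rw [← Finset.sum_add_distrib]
          exact Finset.sum_congr rfl fun z _ => by rw [frameMaj_succ]
      _ ≤ ((d : ℝ) * L) * PS * (∑ y ∈ periodBox (d := d) (N * L ^ (j + 1)), ∑ μ : Fin d, stepMaj d L x ω y μ) + ((d : ℝ) * L) * S := by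
          refine add_le_add ih ?_
          have h := htree
          simp only [Nat.cast_pow] at h ⊢
          exact h
      _ ≤ ((d : ℝ) * L) * PS * (γ 0 * S) + ((d : ℝ) * L) * S :=
          add_le_add (mul_le_mul_of_nonneg_left hstep (mul_nonneg hdL hPS0)) le_rfl
      _ = (((d : ℝ) * L) * (PS * γ 0 + 1)) * S := by ring
      _ = _ := by rw [← htarget]

/-! ## §3 THE `C_F` LETTER AT A CURVED BACKGROUND -/

/-- **THE `ℓ¹` LETTER OF THE ACCUMULATED FRAME POTENTIAL AT ANY `W` OF THE CLASS**: for unitary `W`, `0 ≤ x`, `LevelSmall d L k x`, `SmallField W x`, `L ≥ 1`, and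
an `(N·L^{k+1})`-periodic direction field `Y`:
`Σ_{z∈[0,N)^d} ‖framePotW L (k+1) W Y z‖ ≤ (d·L)·(Σ_{i<k+1} Π_{l<i} (L∕L^d + d·wlin(x_l)·c_loc))·dirL1 Y (periodBox (N·L^{k+1}))`. [folklore] -/
theorem sum_norm_framePotW_le {n : Type*} [Fintype n] [DecidableEq n] [Nonempty n] {L : ℕ} (hL : 1 ≤ L) (k : ℕ) {N : ℕ} [NeZero N]
    {W : Site d → Fin d → (Matrix n n ℂ)ˣ} {x : ℝ} (hWu : IsUnitaryCfg W) (hx : 0 ≤ x) (hs : LevelSmall d L k x) (hWx : SmallField W x)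
    {Y : Site d → Fin d → Matrix n n ℂ} (hYP : IsPeriodicDir Y ((N * L ^ (k + 1) : ℕ) : ℤ)) :
    ∑ z ∈ periodBox (d := d) N, ‖framePotW L (k + 1) W Y z‖
      ≤ (((d : ℝ) * L) * ∑ i ∈ Finset.range (k + 1), ∏ l ∈ Finset.range i, ((L : ℝ) / (L : ℝ) ^ d
            + (d : ℝ) * wlin d L ((prop1Radius d L)^[l] x) * (1250 * ((nbRad d L : ℝ) + L) + 8 * ((d : ℝ) * L) + 2 * L)))
        * dirL1 Y (periodBox (d := d) (N * L ^ (k + 1))) := by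
  set ω : Site d → Fin d → ℝ := fun y μ => ‖Y y μ‖ with hω
  have hω0 : ∀ (y : Site d) (μ : Fin d), 0 ≤ ω y μ := fun y μ => norm_nonneg _
  have hωP : ∀ (y : Site d) (i : Fin d) (μ : Fin d), ω (y + ((N * L ^ (k + 1) : ℕ) : ℤ) • e i) μ = ω y μ := fun y i μ => by
    simp only [hω, hYP y i μ]
  have hdom : ∀ (y : Site d) (μ : Fin d), ‖Y y μ‖ ≤ ω y μ := fun y μ => le_rfl
  have hpt := norm_framePotW_le_frameMaj hL k hWu hx hs hWx hdom
  have htower := sum_periodBox_frameMaj_le (d := d) hL k N x hx ω hω0 hωP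
  have hS : ∑ y ∈ periodBox (d := d) (N * L ^ (k + 1)), ∑ μ : Fin d, ω y μ = dirL1 Y (periodBox (d := d) (N * L ^ (k + 1))) := rfl
  rw [hS] at htower
  exact (Finset.sum_le_sum fun z _ => hpt z).trans htower

/-! ## §4 The `k`-free constant -/

/-- **THE `C_F` LETTER WITH `K_maj`** (`2 ≤ d`, `2 ≤ L`): under the data of §3,
`Σ_{z∈[0,N)^d} ‖framePotW L (k+1) W Y z‖ ≤ 2·(d·L)·K_maj·dirL1 Y (periodBox (N·L^{k+1}))`, `K_maj = exp((L^d∕L)·d·16(d+1)(d+4)L²·c_loc·2∕twoLevelSmall)` —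
each partial product `Π_{l<i} γ(x_l) ≤ K_maj·(L∕L^d)^i` (`NE7MajorantL1.prod_step_le` at depth `i − 1`, `levelSmall_of_le`) and `Σ_i (L∕L^d)^i ≤ 2`. [folklore] -/
theorem sum_norm_framePotW_le_Kmaj {n : Type*} [Fintype n] [DecidableEq n] [Nonempty n] (hd : 2 ≤ d) {L : ℕ} (hL : 2 ≤ L) (k : ℕ) {N : ℕ} [NeZero N]
    {W : Site d → Fin d → (Matrix n n ℂ)ˣ} {x : ℝ} (hWu : IsUnitaryCfg W) (hx : 0 ≤ x) (hs : LevelSmall d L k x) (hWx : SmallField W x)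
    {Y : Site d → Fin d → Matrix n n ℂ} (hYP : IsPeriodicDir Y ((N * L ^ (k + 1) : ℕ) : ℤ)) :
    ∑ z ∈ periodBox (d := d) N, ‖framePotW L (k + 1) W Y z‖
      ≤ (2 * ((d : ℝ) * L) * Real.exp (((L : ℝ) ^ d / L) * ((d : ℝ) * (16 * ((d : ℝ) + 1) * ((d : ℝ) + 4) * (L : ℝ) ^ 2)
            * (1250 * ((nbRad d L : ℝ) + L) + 8 * ((d : ℝ) * L) + 2 * L)) * (2 / twoLevelSmall d L)))
        * dirL1 Y (periodBox (d := d) (N * L ^ (k + 1))) := by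
  have hL1 : 1 ≤ L := by omega
  have h := sum_norm_framePotW_le hL1 k hWu hx hs hWx hYP
  refine h.trans (mul_le_mul_of_nonneg_right ?_ (by unfold dirL1; exact Finset.sum_nonneg fun _ _ => Finset.sum_nonneg fun _ _ => norm_nonneg _))
  set K : ℝ := Real.exp (((L : ℝ) ^ d / L) * ((d : ℝ) * (16 * ((d : ℝ) + 1) * ((d : ℝ) + 4) * (L : ℝ) ^ 2)
            * (1250 * ((nbRad d L : ℝ) + L) + 8 * ((d : ℝ) * L) + 2 * L)) * (2 / twoLevelSmall d L)) with hK
  have hK1 : 1 ≤ K := by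
    rw [hK]
    have h2 : (0 : ℝ) < twoLevelSmall d L := by unfold twoLevelSmall; positivity
    exact Real.one_le_exp (by positivity)
  set q : ℝ := (L : ℝ) / (L : ℝ) ^ d with hq
  have hL2 : (2 : ℝ) ≤ L := by exact_mod_cast hL
  have hq0 : 0 ≤ q := by rw [hq]; positivity
  have hqhalf : q ≤ 1 / 2 := by
    rw [hq, div_le_iff₀ (by positivity)]
    have hLd : (L : ℝ) * L ≤ (L : ℝ) ^ d := by
      calc (L : ℝ) * L = (L : ℝ) ^ 2 := by ring
        _ ≤ (L : ℝ) ^ d := pow_le_pow_right₀ (by linarith) hd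
    nlinarith
  -- each partial product against `K·q^i`
  have hprod : ∀ i ∈ Finset.range (k + 1), (∏ l ∈ Finset.range i, ((L : ℝ) / (L : ℝ) ^ d
      + (d : ℝ) * wlin d L ((prop1Radius d L)^[l] x) * (1250 * ((nbRad d L : ℝ) + L) + 8 * ((d : ℝ) * L) + 2 * L))) ≤ K * q ^ i := by
    intro i hi
    rcases i with _ | i
    · simp only [Finset.prod_range_zero, pow_zero, mul_one]; exact hK1
    · have hik : i ≤ k := by have := Finset.mem_range.mp hi; omega
      have h := prod_step_le (d := d) hL i hx (levelSmall_of_le hik hs)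
      rw [← hK, ← hq] at h
      exact h
  -- the geometric sum
  have hgeom : ∑ i ∈ Finset.range (k + 1), K * q ^ i ≤ 2 * K := by
    rw [← Finset.mul_sum]
    have hg : ∑ i ∈ Finset.range (k + 1), q ^ i ≤ 2 := by
      have hlt : q < 1 := by linarith
      rw [geom_sum_eq (by linarith) (k + 1)]
      rw [div_le_iff_of_neg (by linarith)]
      have : 0 ≤ q ^ (k + 1) := pow_nonneg hq0 _
      nlinarith
    calc K * ∑ i ∈ Finset.range (k + 1), q ^ i ≤ K * 2 := mul_le_mul_of_nonneg_left hg (by linarith)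
      _ = 2 * K := by ring
  have hsum := (Finset.sum_le_sum hprod).trans hgeom
  have hdL : 0 ≤ (d : ℝ) * L := by positivity
  calc ((d : ℝ) * L) * _ ≤ ((d : ℝ) * L) * (2 * K) := mul_le_mul_of_nonneg_left hsum hdL
    _ = 2 * ((d : ℝ) * L) * K := by ring

end

end Summit.QuantumFields.BalabanUV.T4Continuum.NE7FramePotCurvedL1
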